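import Mathlib
import HarnessLib
import Literature.Computability.AlgebraicComplexity.PatternExpressions
import Literature.ModelTheory.FiniteModelTheory.CkEquivHomCount
import Summits.ValiantsHypothesis.ValiantsHypothesis.Theorems.MonotoneRestorationMonotoneRestorationQPLinearWidthDefs
import Summits.ValiantsHypothesis.ValiantsHypothesis.Theorems.MonotoneRestorationOrbitRestorationQPSimpleGraphCut
import Summits.ValiantsHypothesis.ValiantsHypothesis.Theorems.MonotoneRestorationMonotoneRestorationQPLinearWidthSmallWitnessRung

/-!
# Route MonotoneRestoration, crux `MonotoneRestorationQP` (stmt-15886), line `linear_width` —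
# THE SMALL-WITNESS RUNG WITH A SIMPLE-GRAPH INPUT (pebble-game currency)

Helper file (`--supports stmt-ValiantsHypothesis-15886`), def-free.

`SmallWitnessRung.qpOrbitSymm_of_smallWitness` (p840965) closes the rung "degree `≤ N / g(polylog N)`" of the graded
family `WidthRung` modulo the WEIGHTED small-witness distinguishing hypothesis (W1)_g: patterns of treewidth `≥ g(k)` are
distinguished by `HomIndist (g k) k`-pairs of points of `ℂ^{g(k)×g(k)}`.  By the tree's dictionary
(`SimpleGraphCut.eval_indicator_homPoly`: `hom_{E,m}` at the `0/1` adjacency matrix of a simple graph `X` counts graph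
homomorphisms `patternGraph E →g X`; `SimpleGraphCut.homIndist_indicator_of_ckEquiv`: `C^k`-equivalent simple graphs
have `HomIndist m k`-related adjacency matrices, Dvořák's theorem PROVED in the tree) the weighted hypothesis follows from
a purely finite-model-theoretic one:

  (W1-simple)_g : for every `k`, every bipartite pattern without isolated vertices whose pattern graph has treewidth
                  `≥ g(k)` has different numbers of homomorphisms into two `C^k`-EQUIVALENT simple graphs on `g(k)`
                  vertices (Hella's bijective `k`-pebble game, tree `CkEquiv`).

* `smallWitness_of_simpleGraphWitness` — (W1-simple)_g ⇒ (W1)_g;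
* `qpOrbitSymm_of_simpleGraphSmallWitness` — **THE SMALL-WITNESS RUNG, SIMPLE-GRAPH INPUT**: under (W1-simple)_g with
  `g k ≤ (k+2)^e`, every matrix-symmetric family determined at width `(log₂ N + c₀)^c₀` with
  `deg f_N · g((log₂ N + c₀)^c₀) ≤ N` has `QPOrbitSymm`.

What (W1-simple)_g is in print (honest label): for SIMPLE hosts, "treewidth `≥ k` is homomorphism-distinguishing
closed" is Neuen 2024 / Dawar–Pago–Seppelt 2025 Thm 7.3 with witnesses the CFI graphs of the pattern itself (size
exponential in the pattern, NOT small); the SMALL-witness form needs witnesses depending on `k` only — CFI graphs over a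
`poly(k)`-grid (size `poly(k)`, `C^k`-equivalent since the grid has treewidth `≥ k`) together with a transfer of
distinguishability from a grid MINOR of the pattern (polynomial grid-minor theorem, Chekuri–Chuzhoy 2016; oddomorphisms,
Roberson 2022).  None of this is in the tree; (W1-simple)_g is a HYPOTHESIS here.  No stub closed; the rung `θ₁`, the
cruxes and VP ≠ VNP are NOT moved.
[cite: DawarPagoSeppelt2025, Thm 7.3, Thm 7.9; Dvorak2010, Thm 6; DawarWilsenach2025, §3.3]
-/

set_option linter.dupNamespace false

noncomputable section

open scoped Classical

namespace Summit.ValiantsHypothesis.ValiantsHypothesis.Theorems.SmallWitnessRung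

open MvPolynomial Finset
open Literature.Computability.AlgebraicComplexity
open Literature.ModelTheory.FiniteModelTheory
open Summit.ValiantsHypothesis.ValiantsHypothesis.Theorems.MonotoneRestorationQPLinearWidth

/-- **(W1-simple) ⇒ (W1)**: small `C^k`-equivalent simple-graph witnesses with different homomorphism counts from the
pattern graph give small weighted `HomIndist`-witnesses distinguishing the homomorphism polynomial (their `0/1`
adjacency matrices). [cite: Dvorak2010, Thm 6; DwivediPagoSeppelt2026, eq. (1)] -/
theorem smallWitness_of_simpleGraphWitness (g : ℕ → ℕ)
    (hW : ∀ (k a b : ℕ) (E : Multiset (Fin a × Fin b)),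
      (∀ u : Fin a, ∃ x ∈ E, x.1 = u) → (∀ v : Fin b, ∃ x ∈ E, x.2 = v) →
      g k ≤ Literature.Combinatorics.SimpleGraph.treewidth (patternGraph E) →
      ∃ X Y : SimpleGraph (Fin (g k)), CkEquiv k X Y ∧
        Nat.card (patternGraph E →g X) ≠ Nat.card (patternGraph E →g Y))
    (k a b : ℕ) (E : Multiset (Fin a × Fin b))
    (hrow : ∀ u : Fin a, ∃ x ∈ E, x.1 = u) (hcol : ∀ v : Fin b, ∃ x ∈ E, x.2 = v)
    (htw : g k ≤ Literature.Combinatorics.SimpleGraph.treewidth (patternGraph E)) :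
    ∃ z z' : Fin (g k) × Fin (g k) → ℂ, HomIndist (g k) k z z' ∧
      eval z (homPoly E (g k) ℂ) ≠ eval z' (homPoly E (g k) ℂ) := by
  obtain ⟨X, Y, hXY, hne⟩ := hW k a b E hrow hcol htw
  refine ⟨Set.indicator {ij : Fin (g k) × Fin (g k) | X.Adj ij.1 ij.2} 1,
    Set.indicator {ij : Fin (g k) × Fin (g k) | Y.Adj ij.1 ij.2} 1,
    SimpleGraphCut.homIndist_indicator_of_ckEquiv hXY, ?_⟩
  rw [SimpleGraphCut.eval_indicator_homPoly, SimpleGraphCut.eval_indicator_homPoly]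
  exact_mod_cast hne

/-- **THE SMALL-WITNESS RUNG WITH A SIMPLE-GRAPH INPUT.**  Under (W1-simple)_g with `g k ≤ (k+2)^e`: every
matrix-symmetric family `f` determined at width `(log₂ N + c₀)^c₀` at every level and of degree
`deg f_N ≤ N / g((log₂ N + c₀)^c₀)` has square-symmetric circuits of quasi-polynomial orbit size.
[cite: DawarPagoSeppelt2025, Thm 7.3, Thm 7.9; Dvorak2010, Thm 6; DawarWilsenach2025, §3.3] -/
theorem qpOrbitSymm_of_simpleGraphSmallWitness (g : ℕ → ℕ) (e : ℕ) (hg : ∀ k, g k ≤ (k + 2) ^ e)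
    (hW : ∀ (k a b : ℕ) (E : Multiset (Fin a × Fin b)),
      (∀ u : Fin a, ∃ x ∈ E, x.1 = u) → (∀ v : Fin b, ∃ x ∈ E, x.2 = v) →
      g k ≤ Literature.Combinatorics.SimpleGraph.treewidth (patternGraph E) →
      ∃ X Y : SimpleGraph (Fin (g k)), CkEquiv k X Y ∧
        Nat.card (patternGraph E →g X) ≠ Nat.card (patternGraph E →g Y))
    (f : (n : ℕ) → MvPolynomial (Fin n × Fin n) ℂ) (hsym : IsMatrixSymmetric f) (c₀ : ℕ)
    (hdet : ∀ (n : ℕ) (A B : Fin n × Fin n → ℂ), HomIndist n ((Nat.log 2 n + c₀) ^ c₀) A B →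
      eval A (f n) = eval B (f n))
    (hdeg : ∀ n : ℕ, (f n).totalDegree * g ((Nat.log 2 n + c₀) ^ c₀) ≤ n) :
    QPOrbitSymm f :=
  qpOrbitSymm_of_smallWitness g e hg
    (fun k a b E hrow hcol htw => smallWitness_of_simpleGraphWitness g hW k a b E hrow hcol htw)
    f hsym c₀ hdet hdeg

/-! ### Status of the hypothesis and the width-free form (appended)

PRECISE STATUS OF (W1-simple)_g (correction of the wording above, after re-reading Dawar–Pago–Seppelt 2025 §7.1.1).
For a FIXED width `k`, Thm 7.3 loc. cit. (with Prop. 7.4 for fixed bipartitions and Dvořák's theorem) gives exactly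
(W1-simple) at `k` with SOME witness size `g(k)` — the bound `f(χ) = χ·(N_k·2^{N_k−1} + 1)` at chromatic number `χ = 2`,
where `N_k` is the largest minimal forbidden minor of treewidth `< k` (Robertson–Seymour; not explicit).  So
(W1-simple)_g is IN PRINT for a non-explicit `g`, and the paper's dichotomy (Thm 7.9) is the BOUNDED-width regime.  The
rung of this line lives at POLYLOGARITHMIC width `k = (log₂ N + c₀)^c₀`, where `qpOrbitSymm_of_simpleGraphSmallWitness`
needs `g` POLYNOMIAL (`g k ≤ (k+2)^e`, so that `g(k)` is again a polylogarithm and `deg f_N · g(k) ≤ N` is a sublinear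
degree budget): THAT quantitative form is NOT in print — the natural route (polynomial grid-minor theorem, CFI graphs
over a bounded-degree grid-like minor, oddomorphism transfer à la Roberson 2022 replacing the forbidden-minor step of
Thm 7.3) is an unverified assembly.  The theorem below records what the in-print, non-explicit `g` gives: NARROWNESS of
`f_N` at width `g((log₂ N + c₀)^c₀)` (no circuit bound claimed).
-/

/-- **Width-free form (in-print-shaped input).**  Under (W1-simple)_g for an ARBITRARY `g`, a matrix-symmetric family
determined at width `(log₂ N + c₀)^c₀` with `deg f_N · g((log₂ N + c₀)^c₀) ≤ N` is, at level `N`, a linear combination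
of homomorphism polynomials of patterns of treewidth `< g((log₂ N + c₀)^c₀)`.  (With `g` polynomial this width is a
polylogarithm and K2/K3 compile it into quasi-polynomial orbits: `qpOrbitSymm_of_simpleGraphSmallWitness`.)
[cite: DawarPagoSeppelt2025, Thm 7.3, Prop 7.4, Thm 7.11; Dvorak2010, Thm 6] -/
theorem mem_narrowSpan_of_simpleGraphWitness (g : ℕ → ℕ)
    (hW : ∀ (k a b : ℕ) (E : Multiset (Fin a × Fin b)),
      (∀ u : Fin a, ∃ x ∈ E, x.1 = u) → (∀ v : Fin b, ∃ x ∈ E, x.2 = v) →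
      g k ≤ Literature.Combinatorics.SimpleGraph.treewidth (patternGraph E) →
      ∃ X Y : SimpleGraph (Fin (g k)), CkEquiv k X Y ∧
        Nat.card (patternGraph E →g X) ≠ Nat.card (patternGraph E →g Y))
    (f : (n : ℕ) → MvPolynomial (Fin n × Fin n) ℂ) (hsym : IsMatrixSymmetric f) (c₀ : ℕ)
    (hdet : ∀ (n : ℕ) (A B : Fin n × Fin n → ℂ), HomIndist n ((Nat.log 2 n + c₀) ^ c₀) A B →
      eval A (f n) = eval B (f n))
    (N : ℕ) (hdeg : (f N).totalDegree * g ((Nat.log 2 N + c₀) ^ c₀) ≤ N) :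
    f N ∈ Submodule.span ℂ
      {q : MvPolynomial (Fin N × Fin N) ℂ | ∃ (a b : ℕ) (E : Multiset (Fin a × Fin b)),
        Literature.Combinatorics.SimpleGraph.treewidth
            (SimpleGraph.fromRel fun u v : Fin a ⊕ Fin b => ∃ e ∈ E, u = Sum.inl e.1 ∧ v = Sum.inr e.2) <
              g ((Nat.log 2 N + c₀) ^ c₀) ∧
          q = homPoly E N ℂ} := by
  obtain ⟨M, a, b, E, α, -, hdeg', -, hrow, hcol, hiso, hfe⟩ :=
    IsolationAnyLevel.exists_nonIso_expansion_of_matrixSymmetric (f N) (hsym N)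
  have hdet' : ∀ A B : Fin N × Fin N → ℂ, HomIndist N ((Nat.log 2 N + c₀) ^ c₀) A B →
      eval A (∑ i, C (α i) * homPoly (E i) N ℂ) = eval B (∑ i, C (α i) * homPoly (E i) N ℂ) := by
    intro A B hAB
    rw [← hfe]
    exact hdet N A B hAB
  rw [hfe]
  exact IsolationAnyLevel.mem_narrowSpan_of_determined_of_distinguishable₂
    (K := g ((Nat.log 2 N + c₀) ^ c₀)) hdeg a b E α hdeg' hrow hcol hiso hdet'
    fun i hk => smallWitness_of_simpleGraphWitness g hW _ (a i) (b i) (E i) (hrow i) (hcol i) hk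

end Summit.ValiantsHypothesis.ValiantsHypothesis.Theorems.SmallWitnessRung

end
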